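/-
Copyright (c) 2026. All rights reserved.
Released under Apache 2.0 license as described in the file LICENSE.
Authors: abc-iut cell — seat abc-iut-f-099 (block F fact-proving wave, tranche 99; FACT-LIST row F-0126,
positive instance form).  Proof-only; no new definitions.
-/
import Literature.AnabelianGeometry.AbsoluteAnabelian.ParallelogramsPlanarCoorient
import HarnessLib

/-!
# [AbsTopIII] Prop 2.5 (b): the recovered relation "parallel" IS classical parallelism (proof-only)

S. Mochizuki, *Topics in absolute anabelian geometry III*, Prop. 2.5 (b) p. 56 (bib key
`MochizukiAbsTopIII2015`): two line segments of `(U, 𝒬)` are *parallel* if they are equivalent for the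
equivalence relation generated by inclusion and strict parallelism (being opposite sides of a member
of `𝒬`).  For the printed input data — `U ⊆ ℂ` a CONNECTED open subset, `𝒮(U) ⊆ 𝒬 ⊆ 𝒫(U)` (in particular
`𝒬 = 𝒮(U)`, `ℛ(U)`, `𝒫(U)`) — the tree already had one half of the dictionary:
`Parallelograms.Parallel.exists_sub_eq_mul` (parallel line segments have real-proportional directions)
and the one-parallelogram instance `Parallelograms.parallel_opposite_edges`.  This file proves the
converse and hence the full characterisation:

* `Parallelograms.parallel_translate` — two translates `[x, x + v]`, `[y, y + v]` of one non-degenerate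
  segment inside a ball contained in `U` are parallel (two parallelogram steps through a sideways
  offset, so that collinear translates are covered as well);
* `Parallelograms.parallel_of_sub_eq_mul` — ANY two non-degenerate closed segments `[a, b], [a', b'] ⊆ U`
  with `b' − a' ∈ ℝ · (b − a)` are parallel line segments of `(U, 𝒬)` (continuity method along the
  connected open `U`: the set of points carrying a short translate of `[a, b]` parallel to `[a, b]` is
  open and relatively closed);
* `Parallelograms.parallel_iff` — `Parallel 𝒬 L L'` **iff** `L = [a, b] ∩ U`-trace, `L' = [a', b']`,
  non-degenerate, contained in `U`, with real-proportional directions; specialisations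
  `parallel_squares_iff` (`𝒬 = 𝒮(U)`) and `parallel_parallelograms_iff` (`𝒬 = 𝒫(U)`).

Connectedness of `U` is needed: sides of a member of `𝒬 ⊆ 𝒫(U)` lie in one closed parallelogram
`⊆ U`, so parallel line segments always lie in the same connected component of `U`.  With
`ParallelogramsRelationsClosureRefuted.lean` (negative instances, universal closure refuted) this
completes the instance-level description of FACT-LIST row F-0126 (`Parallelograms.Parallel`) at the
printed model.  Refereed pre-IUT material; nothing here bears on the disputed [IUTchIII] Cor. 3.12.
-/

namespace Literature.AnabelianGeometry.AbsoluteAnabelian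

open _root_.Complex _root_.Set _root_.Topology _root_.Metric

noncomputable section

/-! ### Auxiliary: independence from the imaginary part of the ratio -/

/-- `v` and `w` are `ℝ`-independent as soon as `Im (w / v) ≠ 0` (`v ≠ 0`).
(Auxiliary.) [cite: MochizukiAbsTopIII2015, Proposition 2.5 (proof) pp.55–57] -/
theorem linearIndependent_pair_of_div_im_ne_zero {v w : ℂ} (hv : v ≠ 0) (h : (w / v).im ≠ 0) :
    LinearIndependent ℝ ![v, w] := by
  have hw : w = (w / v) * v := by field_simp
  rw [hw, linearIndependent_pair_iff_det, det_mul_self]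
  refine mul_ne_zero h ?_
  have : v.re * v.re + v.im * v.im = Complex.normSq v := by
    rw [Complex.normSq_apply]
  rw [this]
  exact (Complex.normSq_pos.2 hv).ne'

namespace Parallelograms

variable {U : Set ℂ}

/-! ### The relation `Parallel` is an equivalence relation on line segments containing inclusion -/

/-- `Parallel` is transitive. (Auxiliary.) [cite: MochizukiAbsTopIII2015, Proposition 2.5 (b) p.56] -/
theorem Parallel.trans {U : Type*} {𝒬 : Set (Set U)} {L L' L'' : Set U}
    (h : Parallel 𝒬 L L') (h' : Parallel 𝒬 L' L'') : Parallel 𝒬 L L'' :=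
  ⟨h.1, h'.2.1, Relation.EqvGen.trans _ _ _ h.2.2 h'.2.2⟩

/-- A line segment is parallel to itself. (Auxiliary.) [cite: MochizukiAbsTopIII2015, Proposition 2.5 (b) p.56] -/
theorem parallel_refl {U : Type*} {𝒬 : Set (Set U)} {L : Set U} (h : IsLineSegment 𝒬 L) :
    Parallel 𝒬 L L :=
  ⟨h, h, Relation.EqvGen.refl _⟩

/-- Nested line segments are parallel (inclusion is one of the two generating relations).
[cite: MochizukiAbsTopIII2015, Proposition 2.5 (b) p.56] -/
theorem parallel_of_subset {U : Type*} {𝒬 : Set (Set U)} {L L' : Set U} (hL : IsLineSegment 𝒬 L)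
    (hL' : IsLineSegment 𝒬 L') (h : L ⊆ L') : Parallel 𝒬 L L' :=
  ⟨hL, hL', Relation.EqvGen.rel _ _ ⟨hL, hL', Or.inl h⟩⟩

/-! ### Shrinking a segment at one end -/

/-- `[x, x + t' u] ⊆ [x, x + t u]` for `0 < t' ≤ t`. (Auxiliary.)
[cite: MochizukiAbsTopIII2015, Proposition 2.5 (proof) pp.55–57] -/
theorem segment_subset_segment_of_le (x u : ℂ) {t t' : ℝ} (ht' : 0 < t') (htt : t' ≤ t) :
    segment ℝ x (x + (t' : ℂ) * u) ⊆ segment ℝ x (x + (t : ℂ) * u) := by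
  have ht : 0 < t := lt_of_lt_of_le ht' htt
  refine (convex_segment _ _).segment_subset (left_mem_segment _ _ _)
    (mem_segment_of_eq_add_mul (μ := t' / t) (by positivity) (div_le_one_of_le₀ htt ht.le) ?_)
  have htC : (t : ℂ) ≠ 0 := by exact_mod_cast ht.ne'
  push_cast
  field_simp
  ring

/-- For `U ⊆ ℂ` open, `𝒮(U) ⊆ 𝒬 ⊆ 𝒫(U)`, `u ≠ 0`, `0 < t' ≤ t` and `[x, x + t u] ⊆ U`: the line segments
`[x, x + t u]` and `[x, x + t' u]` of `(U, 𝒬)` are parallel (inclusion step).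
[cite: MochizukiAbsTopIII2015, Proposition 2.5 (b) p.56] -/
theorem parallel_shrink (hU : IsOpen U) {𝒬 : Set (Set U)}
    (h𝒬 : ∀ Q ∈ 𝒬, Subtype.val '' Q ∈ parallelogramsIn U)
    (h𝒮 : ∀ Q : Set U, Subtype.val '' Q ∈ squaresIn U → Q ∈ 𝒬) {u : ℂ} (hu : u ≠ 0) {x : ℂ}
    {t t' : ℝ} (ht' : 0 < t') (htt : t' ≤ t) (hsub : segment ℝ x (x + (t : ℂ) * u) ⊆ U) :
    Parallel 𝒬 (Subtype.val ⁻¹' segment ℝ x (x + (t : ℂ) * u))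
      (Subtype.val ⁻¹' segment ℝ x (x + (t' : ℂ) * u)) := by
  have ht : 0 < t := lt_of_lt_of_le ht' htt
  have hne : ∀ {s : ℝ}, 0 < s → x ≠ x + (s : ℂ) * u := by
    intro s hs h
    have h0 : (s : ℂ) * u = 0 := by linear_combination -h
    rcases mul_eq_zero.1 h0 with h1 | h1
    · exact hs.ne' (by exact_mod_cast h1)
    · exact hu h1
  have hsub' := segment_subset_segment_of_le x u ht' htt
  exact (parallel_of_subset (isLineSegment_of_segment_subset hU h𝒬 h𝒮 (hne ht') (hsub'.trans hsub))
    (isLineSegment_of_segment_subset hU h𝒬 h𝒮 (hne ht) hsub) (preimage_mono hsub')).symm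

/-! ### Translating a segment inside a ball: two parallelogram steps -/

/-- **Prop 2.5 (b), translates are parallel.**  For `U ⊆ ℂ` open, `𝒮(U) ⊆ 𝒬 ⊆ 𝒫(U)`, a ball `B(x, ε) ⊆ U`,
`v ≠ 0` and `y` with `‖y − x‖ + ‖v‖ < ε`, the line segments `[x, x + v]` and `[y, y + v]` of `(U, 𝒬)` are
PARALLEL: go from `[x, x + v]` to the sideways translate `[x + γ i v, x + γ i v + v]` (opposite sides of
a parallelogram inside the ball, `parallel_opposite_edges`) with `γ > 0` small and `γ ≠ Im((y − x)/v)`,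
then from there to `[y, y + v]` (again opposite sides of a non-degenerate parallelogram inside the
ball). [cite: MochizukiAbsTopIII2015, Proposition 2.5 (b) p.56] -/
theorem parallel_translate (hU : IsOpen U) {𝒬 : Set (Set U)}
    (h𝒬 : ∀ Q ∈ 𝒬, Subtype.val '' Q ∈ parallelogramsIn U)
    (h𝒮 : ∀ Q : Set U, Subtype.val '' Q ∈ squaresIn U → Q ∈ 𝒬) {v : ℂ} (hv : v ≠ 0) {x y : ℂ}
    {ε : ℝ} (hball : ball x ε ⊆ U) (hy : ‖y - x‖ + ‖v‖ < ε) :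
    Parallel 𝒬 (Subtype.val ⁻¹' segment ℝ x (x + v)) (Subtype.val ⁻¹' segment ℝ y (y + v)) := by
  have hv0 : 0 < ‖v‖ := norm_pos_iff.2 hv
  -- the room left in the ball
  obtain ⟨η, hη0, hηε⟩ : ∃ η : ℝ, 0 < η ∧ ‖y - x‖ + ‖v‖ + η = ε :=
    ⟨ε - (‖y - x‖ + ‖v‖), by linarith, by ring⟩
  -- the sideways coefficient
  obtain ⟨γ, hγ0, hγη, hγζ⟩ : ∃ γ : ℝ, 0 < γ ∧ 2 * (γ * ‖v‖) < η ∧ γ ≠ ((y - x) / v).im := by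
    have hγ1 : 0 < η / (4 * ‖v‖) := by positivity
    have hγ1v : η / (4 * ‖v‖) * ‖v‖ = η / 4 := by field_simp
    by_cases h : ((y - x) / v).im = η / (4 * ‖v‖)
    · refine ⟨η / (4 * ‖v‖) / 2, by positivity, ?_, ?_⟩
      · have : η / (4 * ‖v‖) / 2 * ‖v‖ = η / 8 := by field_simp; ring
        rw [this]; linarith
      · rw [h]; exact (half_lt_self hγ1).ne
    · exact ⟨η / (4 * ‖v‖), hγ1, by rw [hγ1v]; linarith, Ne.symm h⟩
  -- step 1: the sideways parallelogram `x + (0,1) v + (0,1) w₁`, `w₁ = γ i v`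
  set w₁ : ℂ := (γ : ℂ) * (I * v) with hw₁
  have hw₁v : w₁ / v = (γ : ℂ) * I := by
    rw [hw₁, ← mul_assoc, mul_div_assoc, div_self hv, mul_one]
  have hnw₁ : ‖w₁‖ = γ * ‖v‖ := by
    rw [hw₁, norm_mul, norm_mul, Complex.norm_real, Complex.norm_I, one_mul,
      Real.norm_of_nonneg hγ0.le]
  have hind₁ : LinearIndependent ℝ ![v, w₁] :=
    linearIndependent_pair_of_div_im_ne_zero hv (by rw [hw₁v]; simpa using hγ0.ne')
  have hcl₁ : closure (openParallelogram x v w₁) ⊆ U := by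
    refine (closure_openParallelogram_subset_closedBall x v w₁).trans
      ((closedBall_subset_ball ?_).trans hball)
    rw [hnw₁]; nlinarith [norm_nonneg (y - x)]
  have h1 := parallel_opposite_edges hU h𝒬 h𝒮 hind₁ hcl₁
  -- step 2: from `x + w₁` to `y`: edge vector `w₂ = y - x - w₁`, `Im (w₂ / v) = Im ((y - x)/v) - γ ≠ 0`
  set w₂ : ℂ := y - x - w₁ with hw₂
  have hw₂v : (w₂ / v).im = ((y - x) / v).im - γ := by
    rw [hw₂, sub_div, hw₁v]; simp
  have hind₂ : LinearIndependent ℝ ![v, w₂] :=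
    linearIndependent_pair_of_div_im_ne_zero hv (by rw [hw₂v]; exact sub_ne_zero.2 (Ne.symm hγζ))
  have hnw₂ : ‖w₂‖ ≤ ‖y - x‖ + γ * ‖v‖ := by
    rw [hw₂, ← hnw₁]; exact norm_sub_le _ _
  have hcl₂ : closure (openParallelogram (x + w₁) v w₂) ⊆ U := by
    refine (closure_openParallelogram_subset_closedBall (x + w₁) v w₂).trans
      ((closedBall_subset_ball' ?_).trans hball)
    rw [dist_eq_norm, add_sub_cancel_left, hnw₁]
    nlinarith
  have h2 := parallel_opposite_edges hU h𝒬 h𝒮 hind₂ hcl₂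
  have hxy : x + w₁ + w₂ = y := by rw [hw₂]; ring
  rw [hxy] at h2
  exact h1.trans h2

/-! ### The continuity method along the connected open `U` -/

/-- **Prop 2.5 (b), classical parallels are parallel.**  For `U ⊆ ℂ` open and CONNECTED,
`𝒮(U) ⊆ 𝒬 ⊆ 𝒫(U)`: two non-degenerate closed segments `[a, b], [a', b'] ⊆ U` whose directions are real
multiples of each other, `b' − a' = r (b − a)`, are PARALLEL line segments of `(U, 𝒬)`.  Proof: the set
of `x ∈ U` such that some short translate `[x, x + t (b − a)] ⊆ U` (`t > 0`) is parallel to `[a, b]` is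
open (`parallel_translate` in a small ball) and closed in `U` (idem, from a nearby point of the set);
it contains `a`, hence all of `U`, in particular `a'` (if `r > 0`) or `b'` (if `r < 0`), where the short
translate and `[a', b']` are nested. [cite: MochizukiAbsTopIII2015, Proposition 2.5 (b) p.56] -/
theorem parallel_of_sub_eq_mul (hU : IsOpen U) (hUc : IsConnected U) {𝒬 : Set (Set U)}
    (h𝒬 : ∀ Q ∈ 𝒬, Subtype.val '' Q ∈ parallelogramsIn U)
    (h𝒮 : ∀ Q : Set U, Subtype.val '' Q ∈ squaresIn U → Q ∈ 𝒬) {a b a' b' : ℂ} (hab : a ≠ b)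
    (ha'b' : a' ≠ b') (hsub : segment ℝ a b ⊆ U) (hsub' : segment ℝ a' b' ⊆ U) {r : ℝ}
    (hr : b' - a' = (r : ℂ) * (b - a)) :
    Parallel 𝒬 (Subtype.val ⁻¹' segment ℝ a b) (Subtype.val ⁻¹' segment ℝ a' b') := by
  set u : ℂ := b - a with hu
  have hu0 : u ≠ 0 := by rw [hu]; exact sub_ne_zero.2 (Ne.symm hab)
  have hnu : 0 < ‖u‖ := norm_pos_iff.2 hu0
  have hL : IsLineSegment 𝒬 (Subtype.val ⁻¹' segment ℝ a b) :=
    isLineSegment_of_segment_subset hU h𝒬 h𝒮 hab hsub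
  have hL' : IsLineSegment 𝒬 (Subtype.val ⁻¹' segment ℝ a' b') :=
    isLineSegment_of_segment_subset hU h𝒬 h𝒮 ha'b' hsub'
  -- the set reached by the continuity method
  set A : Set ℂ := {x | ∃ t : ℝ, 0 < t ∧ segment ℝ x (x + (t : ℂ) * u) ⊆ U ∧
    Parallel 𝒬 (Subtype.val ⁻¹' segment ℝ a b) (Subtype.val ⁻¹' segment ℝ x (x + (t : ℂ) * u))}
    with hA
  have hAU : A ⊆ U := fun x ⟨t, _, hseg, _⟩ => hseg (left_mem_segment _ _ _)
  -- `a ∈ A`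
  have haA : a ∈ A := by
    refine ⟨1, one_pos, ?_, ?_⟩ <;> rw [show a + ((1 : ℝ) : ℂ) * u = b by rw [hu]; push_cast; ring]
    · exact hsub
    · exact parallel_refl hL
  -- the norm of a real multiple of `u`
  have hnorm : ∀ {s : ℝ}, 0 < s → ‖(s : ℂ) * u‖ = s * ‖u‖ := fun hs => by
    rw [norm_mul, Complex.norm_real, Real.norm_of_nonneg hs.le]
  -- shrinking the parameter below a bound
  have hshrink : ∀ {t δ : ℝ}, 0 < t → 0 < δ →
      ∃ t' : ℝ, 0 < t' ∧ t' ≤ t ∧ t' * ‖u‖ ≤ δ := fun {t δ} ht hδ =>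
    ⟨min t (δ / ‖u‖), lt_min ht (by positivity), min_le_left _ _, by
      calc min t (δ / ‖u‖) * ‖u‖ ≤ δ / ‖u‖ * ‖u‖ :=
            mul_le_mul_of_nonneg_right (min_le_right _ _) hnu.le
        _ = δ := by field_simp⟩
  -- a segment `[y, y + v]` with `‖y - x‖ + ‖v‖ < ε` lies in the ball `B(x, ε)`
  have hsegball : ∀ {x y v : ℂ} {ε : ℝ}, ‖y - x‖ + ‖v‖ < ε →
      segment ℝ y (y + v) ⊆ ball x ε := fun {x y v ε} h => by
    refine (convex_ball x ε).segment_subset ?_ ?_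
    · rw [mem_ball, dist_eq_norm]; linarith [norm_nonneg v]
    · rw [mem_ball, dist_eq_norm, show y + v - x = (y - x) + v by ring]
      exact (norm_add_le _ _).trans_lt h
  -- `A` is open
  have hAo : IsOpen A := by
    refine Metric.isOpen_iff.2 fun x ⟨t, ht, hseg, hpar⟩ => ?_
    obtain ⟨ε, hε, hball⟩ := Metric.isOpen_iff.1 hU x (hAU ⟨t, ht, hseg, hpar⟩)
    obtain ⟨t', ht', ht't, ht'u⟩ := hshrink ht (by positivity : 0 < ε / 4)
    have hpar' := hpar.trans (parallel_shrink hU h𝒬 h𝒮 hu0 ht' ht't hseg)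
    refine ⟨ε / 2, by positivity, fun y hy => ?_⟩
    rw [mem_ball, dist_eq_norm] at hy
    have hyv : ‖y - x‖ + ‖(t' : ℂ) * u‖ < ε := by rw [hnorm ht']; linarith
    have hv0 : (t' : ℂ) * u ≠ 0 := mul_ne_zero (by exact_mod_cast ht'.ne') hu0
    exact ⟨t', ht', (hsegball hyv).trans hball,
      hpar'.trans (parallel_translate hU h𝒬 h𝒮 hv0 hball hyv)⟩
  -- `A` is closed in `U`
  have hAc : closure A ∩ U ⊆ A := by
    rintro x ⟨hxA, hxU⟩
    obtain ⟨ε, hε, hball⟩ := Metric.isOpen_iff.1 hU x hxU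
    obtain ⟨y, ⟨t, ht, hseg, hpar⟩, hxy⟩ := Metric.mem_closure_iff.1 hxA (ε / 4) (by positivity)
    rw [dist_eq_norm] at hxy
    obtain ⟨t', ht', ht't, ht'u⟩ := hshrink ht (by positivity : 0 < ε / 4)
    have hpar' := hpar.trans (parallel_shrink hU h𝒬 h𝒮 hu0 ht' ht't hseg)
    have hv0 : (t' : ℂ) * u ≠ 0 := mul_ne_zero (by exact_mod_cast ht'.ne') hu0
    -- work in the ball `B(y, 3ε/4) ⊆ B(x, ε) ⊆ U`
    have hball' : ball y (3 * ε / 4) ⊆ U := by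
      refine Subset.trans (fun z hz => ?_) hball
      rw [mem_ball, dist_eq_norm] at hz ⊢
      have : ‖z - x‖ ≤ ‖z - y‖ + ‖x - y‖ := by
        rw [show z - x = (z - y) - (x - y) by ring]; exact norm_sub_le _ _
      linarith
    have hxv : ‖x - y‖ + ‖(t' : ℂ) * u‖ < 3 * ε / 4 := by rw [hnorm ht']; linarith
    have hxv' : ‖x - x‖ + ‖(t' : ℂ) * u‖ < ε := by rw [sub_self, norm_zero, hnorm ht']; linarith
    exact ⟨t', ht', (hsegball hxv').trans hball,
      hpar'.trans (parallel_translate hU h𝒬 h𝒮 hv0 hball' hxv)⟩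
  -- hence `U ⊆ A`
  have hUA : U ⊆ A :=
    hUc.isPreconnected.subset_of_closure_inter_subset hAo ⟨a, hsub (left_mem_segment _ _ _), haA⟩ hAc
  -- conclude at `a'` (`r > 0`) or at `b'` (`r < 0`)
  have hr0 : r ≠ 0 := by
    rintro rfl
    apply ha'b'
    have : b' - a' = 0 := by rw [hr]; push_cast; ring
    exact (sub_eq_zero.1 this).symm
  -- nesting of two segments from a common endpoint in the direction `u`
  have hnest : ∀ {x : ℂ} {t s : ℝ}, 0 < t → 0 < s → segment ℝ x (x + (t : ℂ) * u) ⊆ U →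
      segment ℝ x (x + (s : ℂ) * u) ⊆ U →
      Parallel 𝒬 (Subtype.val ⁻¹' segment ℝ a b) (Subtype.val ⁻¹' segment ℝ x (x + (t : ℂ) * u)) →
      Parallel 𝒬 (Subtype.val ⁻¹' segment ℝ a b) (Subtype.val ⁻¹' segment ℝ x (x + (s : ℂ) * u)) := by
    intro x t s ht hs hsegt hsegs hpar
    rcases le_total s t with hst | hts
    · exact hpar.trans (parallel_shrink hU h𝒬 h𝒮 hu0 hs hst hsegt)
    · exact hpar.trans (parallel_shrink hU h𝒬 h𝒮 hu0 ht hts hsegs).symm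
  rcases lt_or_gt_of_ne hr0 with hrneg | hrpos
  · -- `r < 0`: work at `b'`, `a' = b' + (-r) u`
    obtain ⟨t, ht, hseg, hpar⟩ := hUA (hsub' (right_mem_segment _ _ _))
    have ha' : a' = b' + ((-r : ℝ) : ℂ) * u := by
      push_cast; linear_combination -hr
    have hsub'' : segment ℝ b' (b' + ((-r : ℝ) : ℂ) * u) ⊆ U := by
      rw [← ha', segment_symm ℝ b' a']; exact hsub'
    have := hnest ht (neg_pos.2 hrneg) hseg hsub'' hpar
    rw [← ha', segment_symm ℝ b' a'] at this
    exact this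
  · -- `r > 0`: work at `a'`, `b' = a' + r u`
    obtain ⟨t, ht, hseg, hpar⟩ := hUA (hsub' (left_mem_segment _ _ _))
    have hb' : b' = a' + (r : ℂ) * u := by linear_combination hr
    have hsub'' : segment ℝ a' (a' + (r : ℂ) * u) ⊆ U := by rw [← hb']; exact hsub'
    have := hnest ht hrpos hseg hsub'' hpar
    rw [← hb'] at this
    exact this

/-! ### The characterisation -/

/-- **[AbsTopIII] Prop 2.5 (b), the recovered parallelism IS classical parallelism.**  For `U ⊆ ℂ`
open and connected and any collection `𝒮(U) ⊆ 𝒬 ⊆ 𝒫(U)`: two subsets `L, L'` of `U` are PARALLEL in the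
sense of the `(U, 𝒬)`-algorithm (equivalence relation on line segments generated by inclusion and
strict parallelism) **iff** they are (the traces of) non-degenerate closed segments `[a, b], [a', b'] ⊆ U`
whose direction vectors are real multiples of each other.
[cite: MochizukiAbsTopIII2015, Proposition 2.5 (b) p.56] -/
theorem parallel_iff (hU : IsOpen U) (hUc : IsConnected U) {𝒬 : Set (Set U)}
    (h𝒬 : ∀ Q ∈ 𝒬, Subtype.val '' Q ∈ parallelogramsIn U)
    (h𝒮 : ∀ Q : Set U, Subtype.val '' Q ∈ squaresIn U → Q ∈ 𝒬) {L L' : Set U} :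
    Parallel 𝒬 L L' ↔
      ∃ a b a' b' : ℂ, a ≠ b ∧ a' ≠ b' ∧ segment ℝ a b ⊆ U ∧ segment ℝ a' b' ⊆ U ∧
        L = Subtype.val ⁻¹' segment ℝ a b ∧ L' = Subtype.val ⁻¹' segment ℝ a' b' ∧
        ∃ r : ℝ, b' - a' = (r : ℂ) * (b - a) := by
  constructor
  · intro h
    obtain ⟨a, b, hab, hsub, rfl⟩ := (isLineSegment_iff_of_subset hU h𝒬 h𝒮).1 h.1
    obtain ⟨a', b', ha'b', hsub', rfl⟩ := (isLineSegment_iff_of_subset hU h𝒬 h𝒮).1 h.2.1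
    have him : ∀ {S : Set ℂ}, S ⊆ U → Subtype.val '' (Subtype.val ⁻¹' S : Set U) = S := fun hS => by
      rw [image_preimage_eq_inter_range, Subtype.range_coe, inter_eq_left.2 hS]
    obtain ⟨r, hr⟩ := h.exists_sub_eq_mul hU h𝒬 h𝒮 hab (him hsub) (him hsub')
    exact ⟨a, b, a', b', hab, ha'b', hsub, hsub', rfl, rfl, r, hr⟩
  · rintro ⟨a, b, a', b', hab, ha'b', hsub, hsub', rfl, rfl, r, hr⟩
    exact parallel_of_sub_eq_mul hU hUc h𝒬 h𝒮 hab ha'b' hsub hsub' hr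

/-- **Prop 2.5 (b) for the printed input data `(U, 𝒮(U))`** (squares): the recovered parallels are the
classical ones. [cite: MochizukiAbsTopIII2015, Proposition 2.5 (b) p.56] -/
theorem parallel_squares_iff (hU : IsOpen U) (hUc : IsConnected U) {L L' : Set U} :
    Parallel {Q : Set U | Subtype.val '' Q ∈ squaresIn U} L L' ↔
      ∃ a b a' b' : ℂ, a ≠ b ∧ a' ≠ b' ∧ segment ℝ a b ⊆ U ∧ segment ℝ a' b' ⊆ U ∧
        L = Subtype.val ⁻¹' segment ℝ a b ∧ L' = Subtype.val ⁻¹' segment ℝ a' b' ∧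
        ∃ r : ℝ, b' - a' = (r : ℂ) * (b - a) :=
  parallel_iff hU hUc (fun _ hQ => squaresIn_subset_parallelogramsIn U hQ) fun _ h => h

/-- **Prop 2.5 (b) for `(U, 𝒫(U))`** (all parallelograms): the recovered parallels are the classical
ones. [cite: MochizukiAbsTopIII2015, Proposition 2.5 (b) p.56] -/
theorem parallel_parallelograms_iff (hU : IsOpen U) (hUc : IsConnected U) {L L' : Set U} :
    Parallel {Q : Set U | Subtype.val '' Q ∈ parallelogramsIn U} L L' ↔
      ∃ a b a' b' : ℂ, a ≠ b ∧ a' ≠ b' ∧ segment ℝ a b ⊆ U ∧ segment ℝ a' b' ⊆ U ∧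
        L = Subtype.val ⁻¹' segment ℝ a b ∧ L' = Subtype.val ⁻¹' segment ℝ a' b' ∧
        ∃ r : ℝ, b' - a' = (r : ℂ) * (b - a) :=
  parallel_iff hU hUc (fun _ hQ => hQ) fun _ h => squaresIn_subset_parallelogramsIn U h

end Parallelograms

end

end Literature.AnabelianGeometry.AbsoluteAnabelian
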